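import Summits.BirchSwinnertonDyer.BirchSwinnertonDyer.Theorems.KimAtThreeFineKatoExpStarGalois
import HarnessLib

/-!
# Galois semilinearity of the DEFINED dual exponential `exp*_ω` BETWEEN TWO `p`-adic extensions `L, L' ⊇ K`:
# the inter-completion (GAL_loc) — kim3 g15's `KimAtThreeFineKatoExpStarGalois.expStarOmega_galois` with the
# automorphism `g : L → L` replaced by a `K`-linear homomorphism `g : L → L'` into a SECOND field
# (crux `KatoKuriharaPortThreeShared`, stmt-BirchSwinnertonDyer-19560; cell `bsd-addord`, seat w2-acc5 gen 6; route W2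
# `KimAtThreeKolyvagin`; `--supports 19560`, helper)

HONEST FRAMING.  TOOL theorems only (no definition, no named fact, no instance, no `sorry`); general prime `p`, general
`p`-adic fields `K ⊆ L`, `K ⊆ L'`; closes nothing; nothing is booked; BSD is not proved by any of this.

## What, and why
Kato's value datum is DEFINED in the kernel through ONE completion `L_{w₀}` of the level field (w2-acc5 g6 `katoLambda`,
`KimAtThreeFineKatoDefinedLambdaExpStarDefs`); its independence of the twist family is proved
(`KimAtThreeFineKatoDefinedLambdaTwist`) from the ONE-field (GAL_loc) of kim3.  Independence of the PLACE `w₀` — and the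
factorwise print shape «`∀ w ∣ p, exp*_{d_w}(loc_w z) = ι_w(x)`» — needs `exp*` transported between TWO completions
`L_{w₀}`, `L_{w₀'}` along the `ℚ_v`-isomorphism `galAdicCompletionEquiv`.  THIS FILE is the `exp*`-half of that:

* `expStarOmega_galois₂` — **inter-completion (GAL_loc)**.  Let `K ⊆ L`, `K ⊆ L'` be `p`-adic fields (continuous
  inclusions), `r : Γ_K → Γ_ℚ`, `δ' ∈ Γ_K`, `s : Γ_{L'} → Γ_L` a continuous homomorphism with `res_L (s τ) = δ'⁻¹ · res_{L'} τ · δ'`,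
  and `g : L →+* L'` over `K` induced by `δ'` on the copies of `L`, `L'` in `K̄` (`ι₀' (δ' • y) = g x` whenever
  `ι₀ y = x ∈ L`, `ι₀ = absClosureEmbedding K L`, `ι₀' = absClosureEmbedding K L'`).  Let `d_K`, `d_L`, `d_{L'}` be Néron
  lines with **(RES)** at `L` AND at `L'` relative to `d_K`, and ONE class `h₀` with `exp*_{d_K} h₀ ≠ 0`.  Then, under the
  Prop-1.2.3 binders over `L` and `L'`, for continuous crossed homomorphisms `c : Γ_L → T_pW`, `c' : Γ_{L'} → T_pW` (tower
  actions) with `c'(τ) = r(δ') · c(s τ)`: **`exp*_{d_{L'}}[c'] = g (exp*_{d_L}[c])`**.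

PROOF ROAD = kim3's, with TWO base-change isomorphisms: `Θ := Φ_{L'} ∘ (δ' •) ∘ Φ_L⁻¹ : B_dR(L) → B_dR(L')`
(`Φ_L : B_dR(K) ≃ B_dR(L)`, `Φ_{L'} : B_dR(K) ≃ B_dR(L')` from `BdRBaseChangeFiltered.exists_fracBdR_ringEquiv_filtered`) is an
injective filtered ring homomorphism, equivariant over `s` and `g`-SEMILINEAR on `L ⊆ B_dR(L)`; w2-c2's ABSTRACT transport
(`KimAtThreeDeepLowerExpStarOmegaTransport`, with `Algebra L L' := g.toAlgebra`) from `(B_dR(L), V|_t)` to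
`(B_dR(L'), V|_{t∘s})`, then `FilZeroLine.map` / `dualExpCoord_map` along the intertwiner `φ = ρ(r δ') : V|_{t∘s} ≅ V|_{t'}`
(`t' = r ∘ res_{L'}`), so `exp*_{d_{L'}}[c'] = e · g (exp*_{d_L}[c])` for one `e ∈ L'ˣ`; `e = 1` by evaluating at restrictions of
a representative of `h₀` (`[τ ↦ r δ' · η₀(δ'⁻¹ res_{L'} τ δ')] = [res_{L'} η₀]`, (RES) at both fields, `g|_K = id`).
NOT here: the Galois bookkeeping producing `(δ', s, g = galAdicCompletionMap τ̃)` for two places `w₀, w₀' ∣ p` of `ℚ(ζ_m)` and the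
conclusion `katoLambda … w₀ … = katoLambda … w₀' …` (successor file).

References: K. Kato, LNM 1553 (1993) Ch. II §1.2.2–1.2.4, Prop. 1.2.3 [Kato1993LNM1553]; K. Kato, Astérisque 295 (2004) §9.4
[Kato2004Asterisque]; O. Brinon, B. Conrad, *CMI notes* (2009) Prop. 6.3.8 [BrinonConrad2009]; J.-M. Fontaine, Astérisque 223
(1994) Exp. II §1.5 [FontaineAsterisque223III]; J.-P. Serre, *Local Fields* (1979) VII §5 Prop. 3 [SerreLocalFields1979].
-/

set_option autoImplicit false
-- the Theorems namespace of a single-conjunct summit repeats the summit name by design (D-0017)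
set_option linter.dupNamespace false

noncomputable section

open scoped TensorProduct
open Field ValuativeRel Function WittVector
open Literature.NumberTheory.GaloisRepresentations
open Literature.NumberTheory.GaloisRepresentations.PeriodRingData
open Literature.NumberTheory.PAdicHodge
open Literature.NumberTheory.EllipticCurves
open Summit.BirchSwinnertonDyer.BirchSwinnertonDyer.Theorems.KimAtThreeDeepLowerExpStarOmega
open Summit.BirchSwinnertonDyer.BirchSwinnertonDyer.Theorems.KimAtThreeDeepLowerExpStarOmegaTransport
open Summit.BirchSwinnertonDyer.BirchSwinnertonDyer.Theorems.KimAtThreeDeepLowerExpStarOmegaRes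
open Summit.BirchSwinnertonDyer.BirchSwinnertonDyer.Theorems.KimAtThreeFineKatoExpStarGalois

namespace Summit.BirchSwinnertonDyer.BirchSwinnertonDyer.Theorems.KimAtThreeFineKatoExpStarGaloisTwo

/-! ### §1 Small inputs for two fields -/

section Inputs

variable {K L L' : Type} [Field K] [Field L] [Field L'] [Algebra K L] [Algebra K L'] (p : ℕ) [Fact p.Prime] [CharZero K]

/-- **`log χ_cyclo` is compatible with the transported conjugation between two fields**: if
`res_L (s τ) = δ'⁻¹ · res_{L'} τ · δ'` then `log χ(s τ) = log χ(τ)`. [cite: Kato1993LNM1553, Ch. II §1.2.2] -/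
theorem logCyclotomic_conj₂ (δ' : absoluteGaloisGroup K) (s : absoluteGaloisGroup L' →ₜ* absoluteGaloisGroup L)
    (hs : ∀ τ, absGaloisRestrict K L (s τ) = δ'⁻¹ * absGaloisRestrict K L' τ * δ') (τ : absoluteGaloisGroup L') :
    logCyclotomic p τ = logCyclotomic p (s τ) := by
  rw [logCyclotomic_absGaloisRestrict (K := K) p τ, logCyclotomic_absGaloisRestrict (K := K) p (s τ), hs,
    logCyclotomic_mul, logCyclotomic_mul]
  have h1 : logCyclotomic p δ'⁻¹ + logCyclotomic p δ' = 0 := by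
    rw [← logCyclotomic_mul, inv_mul_cancel, logCyclotomic_one]
  linear_combination -h1

end Inputs

/-! ### §2 Inter-completion (GAL_loc) -/

section Galois

variable {K L L' : Type} [Field K] [ValuativeRel K] [TopologicalSpace K] [IsNonarchimedeanLocalField K] [CharZero K]
  [Field L] [ValuativeRel L] [TopologicalSpace L] [IsNonarchimedeanLocalField L] [CharZero L] [Algebra K L]
  [Field L'] [ValuativeRel L'] [TopologicalSpace L'] [IsNonarchimedeanLocalField L'] [CharZero L'] [Algebra K L']
  {p : ℕ} [Fact p.Prime]
  [Fact (¬ IsUnit (p : integerC K))] [IsAdicComplete (Ideal.span {(p : integerC K)}) (integerC K)]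
  [Fact (¬ IsUnit (p : integerC L))] [IsAdicComplete (Ideal.span {(p : integerC L)}) (integerC L)]
  [Fact (¬ IsUnit (p : integerC L'))] [IsAdicComplete (Ideal.span {(p : integerC L')}) (integerC L')]
  [Algebra ℚ_[p] K] [Algebra ℚ_[p] L] [Algebra ℚ_[p] L'] [IsScalarTower ℚ_[p] K L] [IsScalarTower ℚ_[p] K L']
  (hK : valuation K p < 1) (hL : valuation L p < 1) (hL' : valuation L' p < 1)
  (W : WeierstrassCurve ℚ) [W.IsElliptic] (r : absoluteGaloisGroup K →ₜ* absoluteGaloisGroup ℚ)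

omit [IsScalarTower ℚ_[p] K L] [IsScalarTower ℚ_[p] K L'] in
include hK in
/-- **Step 1. The twisted period-ring homomorphism `Θ = Φ_{L'} ∘ (δ' •) ∘ Φ_L⁻¹ : B_dR(L) → B_dR(L')`**: injective,
equivariant over `s`, filtered, and `g`-semilinear on `L ⊆ B_dR(L)` (two filtered `res`-equivariant base-change
isomorphisms `Φ_L : B_dR(K) ≃ B_dR(L)`, `Φ_{L'} : B_dR(K) ≃ B_dR(L')` of `exists_fracBdR_ringEquiv_filtered`, the
`Γ_K`-action on `B_dR(K)`, and the `Γ`-equivariance of Fontaine's sections `F̄ → B_dR⁺(F)`).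
[cite: BrinonConrad2009, Prop. 6.3.8] [cite: FontaineAsterisque223III, Exp. II §1.5] -/
theorem exists_periodRing_twist₂ (hcont : Continuous (algebraMap K L)) (hcont' : Continuous (algebraMap K L'))
    (δ' : absoluteGaloisGroup K) (s : absoluteGaloisGroup L' →ₜ* absoluteGaloisGroup L)
    (hs : ∀ τ, absGaloisRestrict K L (s τ) = δ'⁻¹ * absGaloisRestrict K L' τ * δ')
    (g : L →+* L')
    (hg : ∀ (y : AlgebraicClosure K) (x : L), absClosureEmbedding K L y = algebraMap L (AlgebraicClosure L) x →
      absClosureEmbedding K L' (δ' • y) = algebraMap L' (AlgebraicClosure L') (g x)) :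
    ∃ Θ : (bdRPeriodRingData (F := L) (p := p) hL).B →+* (bdRPeriodRingData (F := L') (p := p) hL').B,
      Injective Θ ∧
      (∀ (τ : absoluteGaloisGroup L') (b : (bdRPeriodRingData (F := L) (p := p) hL).B), Θ (s τ • b) = τ • Θ b) ∧
      (∀ b, b ∈ (bdRPeriodRingData (F := L) (p := p) hL).fil 0 → Θ b ∈ (bdRPeriodRingData (F := L') (p := p) hL').fil 0) ∧
      (∀ e : L, Θ (algebraMap L (bdRPeriodRingData (F := L) (p := p) hL).B e) =
        algebraMap L' (bdRPeriodRingData (F := L') (p := p) hL').B (g e)) := by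
  have hFK : Surjective (fontaineTheta (integerC K) p) := surjective_fontaineTheta_integerC hK
  have hFL : Surjective (fontaineTheta (integerC L) p) := surjective_fontaineTheta_integerC hL
  have hFL' : Surjective (fontaineTheta (integerC L') p) := surjective_fontaineTheta_integerC hL'
  haveI := isDomain_bDeRhamPlus hFK
  haveI := isDomain_bDeRhamPlus hFL
  haveI := isDomain_bDeRhamPlus hFL'
  haveI : Algebra.IsAlgebraic K L := algebra_isAlgebraic_of_continuous_algebraMap hcont hK hL
  haveI : Algebra.IsAlgebraic K L' := algebra_isAlgebraic_of_continuous_algebraMap hcont' hK hL'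
  obtain ⟨Φ, hΦs, -, hΦalg, -, hΦfil⟩ := exists_fracBdR_ringEquiv_filtered (ℓ := p) hcont hK hL hFK hFL
  obtain ⟨Φ', hΦ's, -, hΦ'alg, -, hΦ'fil⟩ := exists_fracBdR_ringEquiv_filtered (ℓ := p) hcont' hK hL' hFK hFL'
  let 𝔅K := bdRPeriodRingData (F := K) (p := p) hK
  let 𝔅L := bdRPeriodRingData (F := L) (p := p) hL
  let 𝔅L' := bdRPeriodRingData (F := L') (p := p) hL'
  -- `Φ_{L'}` as a ring homomorphism; `Φ_L⁻¹` is equivariant backwards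
  let Φr' : 𝔅K.B →+* 𝔅L'.B := Φ'.toRingHom
  have hΦr' : ∀ b, Φr' b = Φ' b := fun _ => rfl
  have hΦ's' : ∀ (σ : absoluteGaloisGroup L') (b : 𝔅K.B), Φr' (absGaloisRestrict K L' σ • b) = σ • Φr' b :=
    fun σ b => by rw [hΦr', hΦr']; exact hΦ's σ b
  let Φr : 𝔅K.B →+* 𝔅L.B := Φ.toRingHom
  have hΦr : ∀ b, Φr b = Φ b := fun _ => rfl
  have hΦs'' : ∀ (σ : absoluteGaloisGroup L) (b : 𝔅K.B), Φr (absGaloisRestrict K L σ • b) = σ • Φr b :=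
    fun σ b => by rw [hΦr, hΦr]; exact hΦs σ b
  let Φi : 𝔅L.B →+* 𝔅K.B := Φ.symm.toRingHom
  have hΦΦi : ∀ b, Φr (Φi b) = b := fun b => Φ.apply_symm_apply b
  have hΦsymm : ∀ (σ : absoluteGaloisGroup L) (b : 𝔅L.B), Φi (σ • b) = absGaloisRestrict K L σ • Φi b :=
    fun σ b => by
    apply Φ.injective
    rw [← hΦr, ← hΦr, hΦΦi, hΦs'', hΦΦi]
  -- `Θ`
  refine ⟨Φr'.comp ((MulSemiringAction.toRingHom (absoluteGaloisGroup K) 𝔅K.B δ').comp Φi),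
    Φ'.injective.comp ((MulSemiringAction.toRingEquiv (absoluteGaloisGroup K) 𝔅K.B δ').injective.comp
      Φ.symm.injective), fun τ b => ?_, fun b hb => ?_, fun e => ?_⟩
  · -- equivariance over `s`
    have hστ : δ' * (δ'⁻¹ * absGaloisRestrict K L' τ * δ') = absGaloisRestrict K L' τ * δ' := by group
    change Φr' (δ' • Φi (s τ • b)) = τ • Φr' (δ' • Φi b)
    rw [hΦsymm, hs, ← mul_smul, hστ, mul_smul]
    exact hΦ's' τ _
  · -- filtration
    change Φr' (δ' • Φi b) ∈ 𝔅L'.fil 0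
    rw [hΦr']
    refine (hΦ'fil 0 _).1 (𝔅K.smul_mem_fil δ' 0 _ ((hΦfil 0 (Φi b)).2 ?_))
    rw [← hΦr, hΦΦi]
    exact hb
  · -- `g`-semilinearity on `L ⊆ B_dR(L)`, through Fontaine's sections
    obtain ⟨y, hy⟩ := (absClosureEmbedding_bijective K L).2 (algebraMap L (AlgebraicClosure L) e)
    have heK : (algebraMap L 𝔅L.B e : FracBdR L p) =
        algebraMap (BDeRhamPlus (integerC L) p) (FracBdR L p) (algClosureToBdR hL hFL (absClosureEmbedding K L y)) := by
      rw [hy, algClosureToBdR_algebraMap]; rfl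
    have h1 : Φ.symm (algebraMap L 𝔅L.B e) =
        algebraMap (BDeRhamPlus (integerC K) p) (FracBdR K p) (algClosureToBdR hK hFK y) :=
      Φ.injective (by rw [Φ.apply_symm_apply, hΦalg]; exact heK)
    change Φ' (δ' • Φ.symm (algebraMap L 𝔅L.B e)) = _
    rw [h1, smul_algebraMap_fracBdR, galBdRPlus_algClosureToBdR, hΦ'alg, hg y e hy, algClosureToBdR_algebraMap]
    rfl

omit [ValuativeRel K] [TopologicalSpace K] [IsNonarchimedeanLocalField K]
  [Fact (¬ IsUnit (p : integerC K))] [IsAdicComplete (Ideal.span {(p : integerC K)}) (integerC K)] in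
/-- **Steps 2–3. Transport of `exp*_ω` along `Θ : B_dR(L) → B_dR(L')` and back along the intertwiner `φ = ρ(r δ')`**:
there is ONE scalar `e ∈ L'ˣ` with `exp*_{d_{L'}}[c'] = e · g (exp*_{d_L}[c])` for every pair `c : Γ_L → T_pW`,
`c' : Γ_{L'} → T_pW` with `c'(τ) = r(δ') · c(s τ)` (w2-c2's abstract transport with `Algebra L L' := g.toAlgebra`, then
`FilZeroLine.map` / `dualExpCoord_map` along `φ`). [cite: Kato1993LNM1553, Ch. II §1.2.4 and Prop. 1.2.3] -/
theorem exists_scalar_expStarOmega_conj₂ (δ' : absoluteGaloisGroup K) (s : absoluteGaloisGroup L' →ₜ* absoluteGaloisGroup L)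
    (hs : ∀ τ, absGaloisRestrict K L (s τ) = δ'⁻¹ * absGaloisRestrict K L' τ * δ')
    (g : L →+* L') (hgK : ∀ x : K, g (algebraMap K L x) = algebraMap K L' x)
    (Θ : (bdRPeriodRingData (F := L) (p := p) hL).B →+* (bdRPeriodRingData (F := L') (p := p) hL').B)
    (hΘinj : Injective Θ)
    (hΘs : ∀ (τ : absoluteGaloisGroup L') (b : (bdRPeriodRingData (F := L) (p := p) hL).B), Θ (s τ • b) = τ • Θ b)
    (hΘfil : ∀ b, b ∈ (bdRPeriodRingData (F := L) (p := p) hL).fil 0 →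
      Θ b ∈ (bdRPeriodRingData (F := L') (p := p) hL').fil 0)
    (hΘE : ∀ e : L, Θ (algebraMap L (bdRPeriodRingData (F := L) (p := p) hL).B e) =
      algebraMap L' (bdRPeriodRingData (F := L') (p := p) hL').B (g e))
    (dL : LocalNeronLine W hL (r.comp (absGaloisRestrict K L)))
    (dL' : LocalNeronLine W hL' (r.comp (absGaloisRestrict K L')))
    (hinjL : (bdRPeriodRingData hL).CupLogInjective (logCyclotomic p)
      (localRationalTateRep W p (r.comp (absGaloisRestrict K L))))
    (hexL : ∀ z : contOneCocycles (localRationalTateRep W p (r.comp (absGaloisRestrict K L))).toTopRep,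
      (bdRPeriodRingData hL).HasDualExp (logCyclotomic p)
        (localRationalTateRep W p (r.comp (absGaloisRestrict K L))) fun σ => z.1 σ)
    (hinjL' : (bdRPeriodRingData hL').CupLogInjective (logCyclotomic p)
      (localRationalTateRep W p (r.comp (absGaloisRestrict K L')))) :
    ∃ e : L', e ≠ 0 ∧ ∀ (c : contOneCocycles (localTateRep W p (r.comp (absGaloisRestrict K L))).toTopRep)
      (c' : contOneCocycles (localTateRep W p (r.comp (absGaloisRestrict K L'))).toTopRep),
      (∀ τ, c'.1 τ = r δ' • c.1 (s τ)) →
      expStarOmega hL' (r.comp (absGaloisRestrict K L')) dL' (oneCocycleClass _ c') =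
        e * g (expStarOmega hL (r.comp (absGaloisRestrict K L)) dL (oneCocycleClass _ c)) := by
  let 𝔅L := bdRPeriodRingData (F := L) (p := p) hL
  let 𝔅L' := bdRPeriodRingData (F := L') (p := p) hL'
  let ρ : ContinuousRep (absoluteGaloisGroup L) ℚ_[p] (W.rationalTateModule p) :=
    localRationalTateRep W p (r.comp (absGaloisRestrict K L))
  let ρ' : ContinuousRep (absoluteGaloisGroup L') ℚ_[p] (W.rationalTateModule p) :=
    localRationalTateRep W p (r.comp (absGaloisRestrict K L'))
  have hgp : ∀ q : ℚ_[p], g (algebraMap ℚ_[p] L q) = algebraMap ℚ_[p] L' q := fun q => by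
    rw [IsScalarTower.algebraMap_apply ℚ_[p] K L, hgK, ← IsScalarTower.algebraMap_apply ℚ_[p] K L']
  have hψ : ∀ τ, logCyclotomic p τ = logCyclotomic p (s τ) := logCyclotomic_conj₂ p δ' s hs
  -- the intertwiner `φ = ρ(r δ')` between the conjugate representation `ρ ∘ s` and `ρ'`
  let Rℚ := W.rationalTateGaloisRep p (W.continuous_rationalGaloisRepTate_holds p)
  have hρ : ∀ σ, ρ σ = Rℚ (r (absGaloisRestrict K L σ)) := fun _ => rfl
  have hρ' : ∀ σ, ρ' σ = Rℚ (r (absGaloisRestrict K L' σ)) := fun _ => rfl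
  have hmul : ∀ (a b : absoluteGaloisGroup ℚ) (m : W.rationalTateModule p), Rℚ a (Rℚ b m) = Rℚ (a * b) m :=
    fun a b m => by rw [map_mul]; rfl
  have ht : ∀ τ, r (absGaloisRestrict K L (s τ)) = (r δ')⁻¹ * r (absGaloisRestrict K L' τ) * r δ' :=
    fun τ => by rw [hs, map_mul, map_mul, map_inv]
  let φ : W.rationalTateModule p ≃ₗ[ℚ_[p]] W.rationalTateModule p :=
    LinearEquiv.ofLinear (Rℚ (r δ')) (Rℚ (r δ')⁻¹)
      (LinearMap.ext fun m => by rw [LinearMap.comp_apply, hmul, mul_inv_cancel, map_one]; rfl)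
      (LinearMap.ext fun m => by rw [LinearMap.comp_apply, hmul, inv_mul_cancel, map_one]; rfl)
  have hφapp : ∀ m, φ m = Rℚ (r δ') m := fun _ => rfl
  have hφ : ∀ τ m, φ ((ρ.restrict s) τ m) = ρ' τ (φ m) := fun τ m => by
    rw [ContinuousRep.restrict_apply, hφapp, hφapp, hρ, hρ', ht, hmul, hmul]
    congr 1
    group
  have hφ' : ∀ τ m, φ.symm (ρ' τ m) = (ρ.restrict s) τ (φ.symm m) := fun τ m =>
    φ.injective (by rw [LinearEquiv.apply_symm_apply, hφ, LinearEquiv.apply_symm_apply])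
  have hinj' : 𝔅L'.CupLogInjective (logCyclotomic p) (ρ.restrict s) := cupLogInjective_of_equiv φ hφ hinjL'
  -- the coefficient fields `L → L'` along `g` (for w2-c2's abstract transport along `Θ`)
  letI algLL' : Algebra L L' := g.toAlgebra
  haveI istLL' : @IsScalarTower ℚ_[p] L L' _ algLL'.toSMul _ :=
    @IsScalarTower.of_algebraMap_eq' ℚ_[p] L L' _ _ _ _ algLL' _ (RingHom.ext fun q => (hgp q).symm)
  -- the transported generator on `ρ ∘ s` and its push-forward to `ρ'`; `Fil⁰ D(ρ')` is a line
  let dT : 𝔅L'.FilZeroLine (ρ.restrict s) := filZeroLineTransport s ρ Θ hΘE hΘs hΘfil hΘinj dL (dL'.map φ.symm hφ')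
  let d₁ : 𝔅L'.FilZeroLine ρ' := dT.map φ hφ
  obtain ⟨e, he0, he⟩ := FilZeroLine.exists_ne_zero_and_eq_smul dL' d₁
  refine ⟨e, he0, fun c c' hc' => ?_⟩
  -- (T1) transport along `Θ`: `exp*_{(ρ∘s, dT)}(z ∘ s) = g (exp*_{(ρ, d_L)} z)`
  have hT1 : 𝔅L'.dualExpCoord (logCyclotomic p) (ρ.restrict s) dT.ω (fun τ => (pushRational p c).1 (s τ)) =
      g (𝔅L.dualExpCoord (logCyclotomic p) ρ dL.ω fun σ => (pushRational p c).1 σ) :=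
    dualExpCoord_filZeroLineTransport s ρ Θ hΘE hΘs hΘfil hΘinj dL (dL'.map φ.symm hφ') hψ hinjL hinj'
      (hexL (pushRational p c))
  -- (T2) push along `φ`: `exp*_{(ρ', d₁)}(φ ∘ z ∘ s) = exp*_{(ρ∘s, dT)}(z ∘ s)`
  have hz' : 𝔅L'.HasDualExp (logCyclotomic p) (ρ.restrict s) fun τ => (pushRational p c).1 (s τ) :=
    hasDualExp_transport s ρ Θ hΘE hΘs hΘfil hψ (hexL (pushRational p c))
  have hT2 := FilZeroLine.dualExpCoord_map (ψ := logCyclotomic p) dT φ hφ hinj' hinjL' hz'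
  -- (T3) the pushed crossed homomorphism IS `c'`
  have hcc : (fun τ => φ ((pushRational p c).1 (s τ))) = fun τ => (pushRational p c').1 τ := by
    funext τ
    rw [pushRational_apply, pushRational_apply, hc', hφapp]
    rfl
  rw [hcc] at hT2
  -- (T4) `d₁ = e • d_{L'}`
  have hT4 : 𝔅L'.dualExpCoord (logCyclotomic p) ρ' d₁.ω (fun τ => (pushRational p c').1 τ) =
      e⁻¹ * 𝔅L'.dualExpCoord (logCyclotomic p) ρ' dL'.ω fun τ => (pushRational p c').1 τ := by
    rw [he]
    exact dL'.dualExpCoord_smul he0 _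
  rw [expStarOmega_oneCocycleClass, expStarOmega_oneCocycleClass, ← hT1, ← hT2, hT4, ← mul_assoc,
    mul_inv_cancel₀ he0, one_mul]

omit [ValuativeRel K] [TopologicalSpace K] [IsNonarchimedeanLocalField K] [CharZero K]
  [ValuativeRel L] [TopologicalSpace L] [IsNonarchimedeanLocalField L] [CharZero L]
  [ValuativeRel L'] [TopologicalSpace L'] [IsNonarchimedeanLocalField L'] [CharZero L']
  [Fact (¬ IsUnit (p : integerC K))] [IsAdicComplete (Ideal.span {(p : integerC K)}) (integerC K)]
  [Fact (¬ IsUnit (p : integerC L))] [IsAdicComplete (Ideal.span {(p : integerC L)}) (integerC L)]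
  [Fact (¬ IsUnit (p : integerC L'))] [IsAdicComplete (Ideal.span {(p : integerC L')}) (integerC L')]
  [Algebra ℚ_[p] K] [Algebra ℚ_[p] L] [Algebra ℚ_[p] L'] [IsScalarTower ℚ_[p] K L] [IsScalarTower ℚ_[p] K L'] [W.IsElliptic] in
/-- **Step 4 (conjugation between the two restrictions of a class from `Γ_K`)**: for a continuous crossed homomorphism
`η₀` of `Γ_K`, the crossed homomorphism `τ ↦ r(δ') · η₀(res_L (s τ))` of `Γ_{L'}` is cohomologous to `res_{L'} η₀`
(they differ by the coboundary of `η₀(δ')`; Serre VII §5 Prop. 3). [cite: SerreLocalFields1979, VII §5 Prop. 3] -/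
theorem oneCocycleClass_conj_res_eq₂ (δ' : absoluteGaloisGroup K) (s : absoluteGaloisGroup L' →ₜ* absoluteGaloisGroup L)
    (hs : ∀ τ, absGaloisRestrict K L (s τ) = δ'⁻¹ * absGaloisRestrict K L' τ * δ')
    (η₀ : contOneCocycles (localTateRep W p r).toTopRep)
    (c₁ c₀' : contOneCocycles (localTateRep W p (r.comp (absGaloisRestrict K L'))).toTopRep)
    (hc₁ : ∀ τ, c₁.1 τ = η₀.1 (absGaloisRestrict K L' τ))
    (hc₀' : ∀ τ, c₀'.1 τ = r δ' • η₀.1 (absGaloisRestrict K L (s τ))) :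
    oneCocycleClass _ c₀' = oneCocycleClass _ c₁ := by
  rw [← sub_eq_zero, ← oneCocycleClass_sub, oneCocycleClass_eq_zero_iff]
  refine ⟨η₀.1 δ', fun τ => ?_⟩
  change c₀'.1 τ - c₁.1 τ = r (absGaloisRestrict K L' τ) • η₀.1 δ' - η₀.1 δ'
  rw [hc₀', hc₁, hs]
  -- the cocycle identities of `η₀` on `Γ_K` (acting through `r`)
  have hcoc : ∀ a b : absoluteGaloisGroup K, η₀.1 (a * b) = η₀.1 a + r a • η₀.1 b := fun a b => η₀.2 a b
  have h2 : r δ' • η₀.1 δ'⁻¹ = - η₀.1 δ' := by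
    have h := hcoc δ' δ'⁻¹
    rw [mul_inv_cancel, contOneCocycles.apply_one] at h
    rw [eq_neg_iff_add_eq_zero, add_comm, ← h]
  rw [hcoc, hcoc, smul_add, smul_add, h2, ← mul_smul, ← mul_smul, ← map_mul, ← map_mul]
  have hg1 : δ' * δ'⁻¹ = 1 := mul_inv_cancel δ'
  have hg2 : δ' * (δ'⁻¹ * absGaloisRestrict K L' τ) = absGaloisRestrict K L' τ := by group
  rw [hg1, hg2, map_one, one_smul]
  abel

/-- ★ **Inter-completion (GAL_loc): `exp*_ω` transported from `L` to `L'`** (module docstring): for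
`c'(τ) = r(δ') · c(s τ)`, `exp*_{d_{L'}}[c'] = g (exp*_{d_L}[c])`, under (RES) for `(d_K, d_L)` and for `(d_K, d_{L'})`,
one class with `exp*_{d_K} ≠ 0`, and the Prop-1.2.3 binders over `L` and `L'`.
[cite: Kato1993LNM1553, Ch. II §1.2.4 and Prop. 1.2.3] [cite: Kato2004Asterisque, §9.4 (p. 188)]
[cite: BrinonConrad2009, Prop. 6.3.8] [cite: FontaineAsterisque223III, Exp. II §1.5] -/
theorem expStarOmega_galois₂ (hcont : Continuous (algebraMap K L)) (hcont' : Continuous (algebraMap K L'))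
    (δ' : absoluteGaloisGroup K) (s : absoluteGaloisGroup L' →ₜ* absoluteGaloisGroup L)
    (hs : ∀ τ, absGaloisRestrict K L (s τ) = δ'⁻¹ * absGaloisRestrict K L' τ * δ')
    (g : L →+* L') (hgK : ∀ x : K, g (algebraMap K L x) = algebraMap K L' x)
    (hg : ∀ (y : AlgebraicClosure K) (x : L), absClosureEmbedding K L y = algebraMap L (AlgebraicClosure L) x →
      absClosureEmbedding K L' (δ' • y) = algebraMap L' (AlgebraicClosure L') (g x))
    (dK : LocalNeronLine W hK r) (dL : LocalNeronLine W hL (r.comp (absGaloisRestrict K L)))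
    (dL' : LocalNeronLine W hL' (r.comp (absGaloisRestrict K L')))
    (hinjL : (bdRPeriodRingData hL).CupLogInjective (logCyclotomic p)
      (localRationalTateRep W p (r.comp (absGaloisRestrict K L))))
    (hexL : ∀ z : contOneCocycles (localRationalTateRep W p (r.comp (absGaloisRestrict K L))).toTopRep,
      (bdRPeriodRingData hL).HasDualExp (logCyclotomic p)
        (localRationalTateRep W p (r.comp (absGaloisRestrict K L))) fun σ => z.1 σ)
    (hinjL' : (bdRPeriodRingData hL').CupLogInjective (logCyclotomic p)
      (localRationalTateRep W p (r.comp (absGaloisRestrict K L'))))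
    (hres : ∀ y : (localTateRep W p r).cohomology 1,
      expStarOmega hL (r.comp (absGaloisRestrict K L)) dL
          ((localTateRep W p r).cohomologyRes (absGaloisRestrict K L) 1 y) =
        algebraMap K L (expStarOmega hK r dK y))
    (hres' : ∀ y : (localTateRep W p r).cohomology 1,
      expStarOmega hL' (r.comp (absGaloisRestrict K L')) dL'
          ((localTateRep W p r).cohomologyRes (absGaloisRestrict K L') 1 y) =
        algebraMap K L' (expStarOmega hK r dK y))
    (h₀ : (localTateRep W p r).cohomology 1) (hh₀ : expStarOmega hK r dK h₀ ≠ 0)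
    (c : contOneCocycles (localTateRep W p (r.comp (absGaloisRestrict K L))).toTopRep)
    (c' : contOneCocycles (localTateRep W p (r.comp (absGaloisRestrict K L'))).toTopRep)
    (hc' : ∀ τ, c'.1 τ = r δ' • c.1 (s τ)) :
    expStarOmega hL' (r.comp (absGaloisRestrict K L')) dL' (oneCocycleClass _ c') =
      g (expStarOmega hL (r.comp (absGaloisRestrict K L)) dL (oneCocycleClass _ c)) := by
  obtain ⟨Θ, hΘinj, hΘs, hΘfil, hΘE⟩ := exists_periodRing_twist₂ hK hL hL' hcont hcont' δ' s hs g hg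
  obtain ⟨e, -, key⟩ := exists_scalar_expStarOmega_conj₂ hL hL' W r δ' s hs g hgK Θ hΘinj hΘs hΘfil hΘE dL dL'
    hinjL hexL hinjL'
  -- ### `e = 1`, by evaluating at the restrictions of a representative of `h₀`
  obtain ⟨η₀, hη₀⟩ := oneCocycleClass_surjective _ h₀
  -- `c₀ = res_L η₀`, `c₁ = res_{L'} η₀`
  let c₀ : contOneCocycles (localTateRep W p (r.comp (absGaloisRestrict K L))).toTopRep :=
    contOneCocycles.pullback (absGaloisRestrict K L)
      (Y := ((localTateRep W p r).restrict (absGaloisRestrict K L)).toTopRep)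
      (TopRep.ofHom ⟨ContinuousLinearMap.id ℤ (W.tateModule p), fun _ => rfl⟩) η₀
  have hc₀ : (localTateRep W p r).cohomologyRes (absGaloisRestrict K L) 1 (oneCocycleClass _ η₀) =
      oneCocycleClass _ c₀ :=
    cohomologyRes_oneCocycleClass _ _ η₀
  have hc₀app : ∀ τ, c₀.1 τ = η₀.1 (absGaloisRestrict K L τ) := fun _ => rfl
  let c₁ : contOneCocycles (localTateRep W p (r.comp (absGaloisRestrict K L'))).toTopRep :=
    contOneCocycles.pullback (absGaloisRestrict K L')
      (Y := ((localTateRep W p r).restrict (absGaloisRestrict K L')).toTopRep)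
      (TopRep.ofHom ⟨ContinuousLinearMap.id ℤ (W.tateModule p), fun _ => rfl⟩) η₀
  have hc₁ : (localTateRep W p r).cohomologyRes (absGaloisRestrict K L') 1 (oneCocycleClass _ η₀) =
      oneCocycleClass _ c₁ :=
    cohomologyRes_oneCocycleClass _ _ η₀
  have hc₁app : ∀ τ, c₁.1 τ = η₀.1 (absGaloisRestrict K L' τ) := fun _ => rfl
  -- `c₀' = τ ↦ r δ' • c₀ (s τ)`, the pull-back of `c₀` along `(s, r δ' • ·)`
  have ht : ∀ τ, r (absGaloisRestrict K L (s τ)) = (r δ')⁻¹ * r (absGaloisRestrict K L' τ) * r δ' :=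
    fun τ => by rw [hs, map_mul, map_mul, map_inv]
  let X₀ := (W.tateGaloisRep p (W.continuous_galoisRepTate_holds p)).toIntRep.toTopRep
  let X := (localTateRep W p (r.comp (absGaloisRestrict K L))).toTopRep
  let X' := (localTateRep W p (r.comp (absGaloisRestrict K L'))).toTopRep
  have hsq : ∀ τ : absoluteGaloisGroup L',
      (X₀.ρ (r δ')).comp ((TopRep.res (s : absoluteGaloisGroup L' →* absoluteGaloisGroup L) X).ρ τ) =
        (X'.ρ τ).comp (X₀.ρ (r δ')) := fun τ => by
    refine ContinuousLinearMap.ext fun a => ?_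
    have hτ : r δ' * ((r δ')⁻¹ * r (absGaloisRestrict K L' τ) * r δ') = r (absGaloisRestrict K L' τ) * r δ' := by
      group
    change r δ' • (r (absGaloisRestrict K L (s τ)) • a) = r (absGaloisRestrict K L' τ) • (r δ' • a)
    rw [← mul_smul, ht, hτ, mul_smul]
  let fδ : TopRep.res (s : absoluteGaloisGroup L' →* absoluteGaloisGroup L) X ⟶ X' := TopRep.ofHom ⟨X₀.ρ (r δ'), hsq⟩
  let c₀' : contOneCocycles (localTateRep W p (r.comp (absGaloisRestrict K L'))).toTopRep :=
    contOneCocycles.pullback s fδ c₀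
  have hc₀' : ∀ τ, c₀'.1 τ = r δ' • c₀.1 (s τ) := fun _ => rfl
  have hc₀'' : ∀ τ, c₀'.1 τ = r δ' • η₀.1 (absGaloisRestrict K L (s τ)) := fun τ => by rw [hc₀', hc₀app]
  have hcl : oneCocycleClass _ c₀' = oneCocycleClass _ c₁ :=
    oneCocycleClass_conj_res_eq₂ W r δ' s hs η₀ c₁ c₀' hc₁app hc₀''
  have hpin := key c₀ c₀' hc₀'
  rw [hcl, ← hc₁, ← hc₀, hη₀, hres h₀, hres' h₀, hgK] at hpin
  have he1 : e = 1 := by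
    have hne : algebraMap K L' (expStarOmega hK r dK h₀) ≠ 0 :=
      (map_ne_zero_iff _ (algebraMap K L').injective).2 hh₀
    have h3 : (e - 1) * algebraMap K L' (expStarOmega hK r dK h₀) = 0 := by
      rw [sub_mul, one_mul, ← hpin, sub_self]
    exact sub_eq_zero.1 ((mul_eq_zero.1 h3).resolve_right hne)
  rw [key c c' hc', he1, one_mul]

end Galois

end Summit.BirchSwinnertonDyer.BirchSwinnertonDyer.Theorems.KimAtThreeFineKatoExpStarGaloisTwo

end
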